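import Mathlib
import Summits.NavierStokesRegularity.NavierStokesRegularity.Theorems.TaoLadderRungTwoBreakBlowupRigidityOneEveryShellFires
import HarnessLib

/-!
# ORDERED IGNITION AND HOP-TIME SUMMABILITY along an exact cascade blow-up: shell `n+1` lights up only after shell `n`,
  each hop costs time `≥ T/(4 U_n²)` against the peak normalised amplitude `U_n ≥ C_A T Λ^{n+1} sup‖x_n‖`, hence
  `Σ_n U_n⁻² < 4` — the peaks of the critical amplitude DIVERGE along all but `4L²` shells — support for
  `stub_eternalFromBlowup` of K2(1) `TaoLadderRungTwoBreak.BlowupRigidityOne` (stmt-NavierStokesRegularity-20206)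

MODEL lattice ODEs only (Tao 2016 §4 (4.3), Lemma 4.1 (4.5)–(4.10), (4.12)); nothing here is a statement about the
Navier–Stokes equations; NO item is closed (`--supports stmt-NavierStokesRegularity-20206`). General `m`; DEF-FREE.

With the normalised amplitude `u_n(s) := C_A · T · Λ^{n+1} · ‖x_n(s)‖` of an exact flow on `[0,T)` from a one-shell datum
(cancelling table), «no spontaneous emission» (`norm_succ_le_action_sq`) reads `u_{n+1}(s) ≤ T⁻¹ ∫₀ˢ u_n(r)² dr`
(`normalised_succ_le_integral_sq`). Consequences (a shell is LIT at time `r` if `u_n(r) ≥ 1/2`; every shell of a blow-up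
gets lit, indeed reaches `u_n > 1`, by `everyShellFires`):
* `orderedIgnition` — shell `n+1` is lit at time `r` only if shell `n` was lit at some `r' ≤ r` (the front is ORDERED);
* `hopTime` — if shell `n` is unlit on `[0,a)`, shell `n+1` is lit at `r`, and `u_n ≤ U` throughout, then `a ≤ r` and
  `T/4 < (r - a) · U²`: a hop against peak amplitude `U` costs physical time `> T/(4U²)`;
* `sum_inv_sq_peak_lt_four` — along a blow-up (critical amplitude unbounded), for ANY peak bounds `u_n ≤ U_n` on `[0,T)`:
  `Σ_{n<N} U_n⁻² < 4` for every `N` (the first-lit times `s_n = inf{u_n ≥ 1/2}` increase with `n` inside `[0,T)` and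
  `s_{n+1} - s_n ≥ T/(4U_n²)` telescopes);
* `card_quietPeaks_le` — hence at most `4L²` shells have peak `≤ L`: the critical-amplitude peaks
  `sup_t Λ^n‖x_n(t)‖` DIVERGE along all but a sparse set of shells (the tree had: `> (C_A T Λ)⁻¹` on every shell,
  `everyShellFires`; unbounded on some shells, `criticalBlowup_of_noGlobalCascade`);
* `hopTimes_of_noGlobalCascade` — the package along the maximal exact flow of every robust blow-up (`NoGlobalCascade`).

HONEST LABEL. A-priori LOWER-bound dynamics at the CRITICAL scaling (`a = 5`): quantitative passage times, unconditional.
The stub's (S₁)-survival / action ceiling / periodicity and `stub_eternalIsDSS` are untouched; no stub, crux or summit is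
proved; rung 0.
-/

noncomputable section

-- the summit and its single sub-problem share the name (CONVENTIONS §1)
set_option linter.dupNamespace false

open Set Filter Topology MeasureTheory intervalIntegral

namespace Summit.NavierStokesRegularity.NavierStokesRegularity.Theorems

namespace BlowupRigidityOne

open Literature.Analysis.FluidPDE Literature.Analysis.FluidPDE.TaoCascade

variable {m : ℕ}

/-- **No spontaneous emission, normalised**: `u_{n+1}(s) ≤ T⁻¹ ∫₀ˢ u_n(r)² dr` for `u_n = C_A T Λ^{n+1}‖x_n‖`.
[cite: Tao2016AveragedNS, §4 (4.3), Lemma 4.1 (4.8)–(4.10); §1.2] -/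
theorem normalised_succ_le_integral_sq {ε₀ T : ℝ} (hε : 0 < ε₀) (hT : 0 < T)
    {α : Fin m → Fin m → Fin m → ℤ × ℤ × ℤ → ℝ} (hc : IsCancellingCoeff α)
    {X : Fin m → ℤ → ℝ → ℝ} {X₀ : Fin m → ℝ}
    (hder : ∀ i k, ∀ t ∈ Ico 0 T, HasDerivWithinAt (X i k) (quadTerm ε₀ α X i k t) (Ici 0) t)
    (hinit : ∀ i k, X i k 0 = if k = 0 then X₀ i else 0)
    (hlow : ∀ i k t, k < 0 → X i k t = 0)
    (hreg : ∀ T' : ℝ, T' < T → ∃ M : ℝ, ∀ t ∈ Icc 0 T', ∀ (i : Fin m) (k : ℤ),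
      (1 + (1 + ε₀) ^ ((10 : ℝ) * k)) * |X i k t| ≤ M)
    (n : ℕ) : ∀ s ∈ Ico 0 T,
      fluxConst α * T * bigLam ε₀ ^ (n + 1 + 1) * ‖shellVec X ((n + 1 : ℕ) : ℤ) s‖ ≤
        T⁻¹ * ∫ r in (0:ℝ)..s, (fluxConst α * T * bigLam ε₀ ^ (n + 1) * ‖shellVec X (n : ℤ) r‖) ^ 2 := by
  intro s hs
  have hL : 0 < bigLam ε₀ := bigLam_pos (by linarith)
  have hCA : 0 ≤ fluxConst α := fluxConst_nonneg α
  have h1 := norm_succ_le_action_sq hε hc hder hinit hlow hreg n s hs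
  have hcast : (((n + 1 : ℕ) : ℤ)) = (n : ℤ) + 1 := by push_cast; ring
  have hsq : ∫ r in (0:ℝ)..s, (fluxConst α * T * bigLam ε₀ ^ (n + 1) * ‖shellVec X (n : ℤ) r‖) ^ 2 =
      (fluxConst α * T * bigLam ε₀ ^ (n + 1)) ^ 2 * ∫ r in (0:ℝ)..s, ‖shellVec X (n : ℤ) r‖ ^ 2 := by
    rw [← intervalIntegral.integral_const_mul]
    exact intervalIntegral.integral_congr fun r _ => by ring
  rw [hcast, hsq]
  calc fluxConst α * T * bigLam ε₀ ^ (n + 1 + 1) * ‖shellVec X ((n : ℤ) + 1) s‖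
      ≤ fluxConst α * T * bigLam ε₀ ^ (n + 1 + 1) *
          (fluxConst α * bigLam ε₀ ^ n * ∫ r in (0:ℝ)..s, ‖shellVec X (n : ℤ) r‖ ^ 2) :=
        mul_le_mul_of_nonneg_left h1 (by positivity)
    _ = T⁻¹ * ((fluxConst α * T * bigLam ε₀ ^ (n + 1)) ^ 2 * ∫ r in (0:ℝ)..s, ‖shellVec X (n : ℤ) r‖ ^ 2) := by
        field_simp
        ring

/-- **ORDERED IGNITION.** If shell `n+1` is lit at time `r ∈ [0,T)` (`1/2 ≤ u_{n+1}(r)`), then shell `n` was lit at some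
`r' ∈ [0,r]` (`1/2 ≤ u_n(r')`): otherwise `∫₀ʳ u_n² ≤ r/4 < T/2 ≤ T u_{n+1}(r)`.
[cite: Tao2016AveragedNS, §4 (4.3), Lemma 4.1 (4.8)–(4.10); §1.2 (energy is fed shell after shell)] -/
theorem orderedIgnition {ε₀ T : ℝ} (hε : 0 < ε₀) (hT : 0 < T)
    {α : Fin m → Fin m → Fin m → ℤ × ℤ × ℤ → ℝ} (hc : IsCancellingCoeff α)
    {X : Fin m → ℤ → ℝ → ℝ} {X₀ : Fin m → ℝ}
    (hder : ∀ i k, ∀ t ∈ Ico 0 T, HasDerivWithinAt (X i k) (quadTerm ε₀ α X i k t) (Ici 0) t)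
    (hinit : ∀ i k, X i k 0 = if k = 0 then X₀ i else 0)
    (hlow : ∀ i k t, k < 0 → X i k t = 0)
    (hreg : ∀ T' : ℝ, T' < T → ∃ M : ℝ, ∀ t ∈ Icc 0 T', ∀ (i : Fin m) (k : ℤ),
      (1 + (1 + ε₀) ^ ((10 : ℝ) * k)) * |X i k t| ≤ M)
    (n : ℕ) {r : ℝ} (hr : r ∈ Ico 0 T)
    (hlit : 1 / 2 ≤ fluxConst α * T * bigLam ε₀ ^ (n + 1 + 1) * ‖shellVec X ((n + 1 : ℕ) : ℤ) r‖) :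
    ∃ r' ∈ Icc 0 r, 1 / 2 ≤ fluxConst α * T * bigLam ε₀ ^ (n + 1) * ‖shellVec X (n : ℤ) r'‖ := by
  by_contra hcon
  push Not at hcon
  have hCA : 0 ≤ fluxConst α := fluxConst_nonneg α
  have hL : 0 < bigLam ε₀ := bigLam_pos (by linarith)
  have h1 := normalised_succ_le_integral_sq hε hT hc hder hinit hlow hreg n r hr
  -- continuity of `u_n` on `[0,r]`
  have hcx : ContinuousOn (fun s => shellVec X (n : ℤ) s) (Ico 0 T) := by
    have hcp : ContinuousOn (fun s => fun i => X i (n : ℤ) s) (Ico 0 T) :=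
      continuousOn_pi.2 fun i s hs => ((hder i _ s hs).continuousWithinAt).mono fun x hx => hx.1
    exact (PiLp.continuous_toLp 2 (fun _ : Fin m => ℝ)).comp_continuousOn hcp
  have hsub : Icc 0 r ⊆ Ico 0 T := fun s hs => ⟨hs.1, lt_of_le_of_lt hs.2 hr.2⟩
  have hcn : ContinuousOn (fun s => fluxConst α * T * bigLam ε₀ ^ (n + 1) * ‖shellVec X (n : ℤ) s‖) (Icc 0 r) :=
    continuousOn_const.mul (hcx.mono hsub).norm
  have hint : ∫ s in (0:ℝ)..r, (fluxConst α * T * bigLam ε₀ ^ (n + 1) * ‖shellVec X (n : ℤ) s‖) ^ 2 ≤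
      ∫ _s in (0:ℝ)..r, (1 / 2 : ℝ) ^ 2 := by
    refine intervalIntegral.integral_mono_on hr.1 ?_ intervalIntegrable_const fun s hs => ?_
    · exact ((hcn.pow 2).mono (by rw [uIcc_of_le hr.1])).intervalIntegrable
    · exact pow_le_pow_left₀ (by positivity) (hcon s hs).le 2
  rw [intervalIntegral.integral_const, smul_eq_mul, sub_zero] at hint
  have h2 : T⁻¹ * ∫ s in (0:ℝ)..r, (fluxConst α * T * bigLam ε₀ ^ (n + 1) * ‖shellVec X (n : ℤ) s‖) ^ 2 ≤
      T⁻¹ * (r * (1 / 2 : ℝ) ^ 2) := mul_le_mul_of_nonneg_left hint (inv_nonneg.2 hT.le)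
  have h3 : T⁻¹ * (r * (1 / 2 : ℝ) ^ 2) < 1 / 2 := by
    rw [show T⁻¹ * (r * (1 / 2 : ℝ) ^ 2) = (r / T) * (1 / 4) by ring]
    have : r / T < 1 := (div_lt_one hT).2 hr.2
    linarith
  linarith

/-- **HOP TIME.** If shell `n` is unlit on `[0,a)` (`u_n < 1/2` there, `0 ≤ a < T`), shell `n+1` is lit at `r ∈ [0,T)`, and
`u_n ≤ U` on `[0,T)`, then `a ≤ r` and `T/4 < (r - a) · U²`: the integral `T/2 ≤ ∫₀ʳ u_n²` collects `< T/4` before `a` and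
at most `(r-a)U²` after.
[cite: Tao2016AveragedNS, §4 (4.3), Lemma 4.1 (4.8)–(4.10); §1.2] -/
theorem hopTime {ε₀ T : ℝ} (hε : 0 < ε₀) (hT : 0 < T)
    {α : Fin m → Fin m → Fin m → ℤ × ℤ × ℤ → ℝ} (hc : IsCancellingCoeff α)
    {X : Fin m → ℤ → ℝ → ℝ} {X₀ : Fin m → ℝ}
    (hder : ∀ i k, ∀ t ∈ Ico 0 T, HasDerivWithinAt (X i k) (quadTerm ε₀ α X i k t) (Ici 0) t)
    (hinit : ∀ i k, X i k 0 = if k = 0 then X₀ i else 0)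
    (hlow : ∀ i k t, k < 0 → X i k t = 0)
    (hreg : ∀ T' : ℝ, T' < T → ∃ M : ℝ, ∀ t ∈ Icc 0 T', ∀ (i : Fin m) (k : ℤ),
      (1 + (1 + ε₀) ^ ((10 : ℝ) * k)) * |X i k t| ≤ M)
    (n : ℕ) {a r U : ℝ} (ha : a ∈ Ico 0 T) (hr : r ∈ Ico 0 T)
    (hunlit : ∀ s ∈ Ico 0 a, fluxConst α * T * bigLam ε₀ ^ (n + 1) * ‖shellVec X (n : ℤ) s‖ < 1 / 2)
    (hlit : 1 / 2 ≤ fluxConst α * T * bigLam ε₀ ^ (n + 1 + 1) * ‖shellVec X ((n + 1 : ℕ) : ℤ) r‖)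
    (hU : ∀ s ∈ Ico 0 T, fluxConst α * T * bigLam ε₀ ^ (n + 1) * ‖shellVec X (n : ℤ) s‖ ≤ U) :
    a ≤ r ∧ T / 4 < (r - a) * U ^ 2 := by
  have hCA : 0 ≤ fluxConst α := fluxConst_nonneg α
  have hL : 0 < bigLam ε₀ := bigLam_pos (by linarith)
  -- `a ≤ r` by ordered ignition
  obtain ⟨r', hr', hlit'⟩ := orderedIgnition hε hT hc hder hinit hlow hreg n hr hlit
  have har : a ≤ r := by
    by_contra h
    push Not at h
    exact absurd (hunlit r' ⟨hr'.1, lt_of_le_of_lt hr'.2 h⟩) (not_lt.2 hlit')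
  refine ⟨har, ?_⟩
  have h1 := normalised_succ_le_integral_sq hε hT hc hder hinit hlow hreg n r hr
  set u : ℝ → ℝ := fun s => fluxConst α * T * bigLam ε₀ ^ (n + 1) * ‖shellVec X (n : ℤ) s‖ with hu_def
  -- continuity of `u` on `[0,r]`
  have hcx : ContinuousOn (fun s => shellVec X (n : ℤ) s) (Ico 0 T) := by
    have hcp : ContinuousOn (fun s => fun i => X i (n : ℤ) s) (Ico 0 T) :=
      continuousOn_pi.2 fun i s hs => ((hder i _ s hs).continuousWithinAt).mono fun x hx => hx.1
    exact (PiLp.continuous_toLp 2 (fun _ : Fin m => ℝ)).comp_continuousOn hcp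
  have hsub : Icc 0 r ⊆ Ico 0 T := fun s hs => ⟨hs.1, lt_of_le_of_lt hs.2 hr.2⟩
  have hcn : ContinuousOn u (Icc 0 r) := continuousOn_const.mul (hcx.mono hsub).norm
  have hui : ∀ b c, b ∈ Icc 0 r → c ∈ Icc 0 r → IntervalIntegrable (fun s => u s ^ 2) volume b c := by
    intro b c hb hc'
    exact ((hcn.pow 2).mono (uIcc_subset_Icc hb hc')).intervalIntegrable
  have h0r : (0:ℝ) ∈ Icc 0 r := ⟨le_rfl, hr.1⟩
  have har' : a ∈ Icc 0 r := ⟨ha.1, har⟩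
  have hrr : r ∈ Icc 0 r := ⟨hr.1, le_rfl⟩
  -- split `∫₀ʳ = ∫₀ᵃ + ∫ₐʳ`
  have hsplit : ∫ s in (0:ℝ)..r, u s ^ 2 = (∫ s in (0:ℝ)..a, u s ^ 2) + ∫ s in a..r, u s ^ 2 :=
    (intervalIntegral.integral_add_adjacent_intervals (hui 0 a h0r har') (hui a r har' hrr)).symm
  -- before `a`: `∫₀ᵃ u² ≤ a/4` (`u < 1/2` on `[0,a)`, and `u(a) ≤ 1/2` by continuity when `a > 0`)
  have hpre : ∫ s in (0:ℝ)..a, u s ^ 2 ≤ a * (1 / 4 : ℝ) := by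
    rcases eq_or_lt_of_le ha.1 with h0 | h0
    · rw [← h0, intervalIntegral.integral_same]; norm_num
    · have hle : ∀ s ∈ Icc 0 a, u s ≤ 1 / 2 := by
        intro s hs
        rcases eq_or_lt_of_le hs.2 with h | h
        · rw [h]
          have hmem : a ∈ closure (Ico 0 a) := by rw [closure_Ico h0.ne]; exact ⟨ha.1, le_rfl⟩
          have hca : ContinuousWithinAt u (Ico 0 a) a :=
            (hcn a har').mono fun x hx => ⟨hx.1, hx.2.le.trans har⟩
          exact hca.closure_le hmem continuousWithinAt_const fun y hy => (hunlit y hy).le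
        · exact (hunlit s ⟨hs.1, h⟩).le
      have hm : ∫ s in (0:ℝ)..a, u s ^ 2 ≤ ∫ _s in (0:ℝ)..a, (1 / 4 : ℝ) := by
        refine intervalIntegral.integral_mono_on ha.1 (hui 0 a h0r har') intervalIntegrable_const fun s hs => ?_
        have h0u : 0 ≤ u s := by positivity
        nlinarith [hle s hs]
      rwa [intervalIntegral.integral_const, smul_eq_mul, sub_zero] at hm
  -- after `a`: `∫ₐʳ u² ≤ (r - a) U²`
  have hU0 : 0 ≤ U := le_trans (by positivity) (hU 0 ⟨le_rfl, hT⟩)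
  have hpost : ∫ s in a..r, u s ^ 2 ≤ (r - a) * U ^ 2 := by
    have hm : ∫ s in a..r, u s ^ 2 ≤ ∫ _s in a..r, U ^ 2 := by
      refine intervalIntegral.integral_mono_on har (hui a r har' hrr) intervalIntegrable_const fun s hs => ?_
      have h0u : 0 ≤ u s := by positivity
      exact pow_le_pow_left₀ h0u (hU s ⟨ha.1.trans hs.1, lt_of_le_of_lt hs.2 hr.2⟩) 2
    rwa [intervalIntegral.integral_const, smul_eq_mul] at hm
  -- assemble: `1/2 ≤ u_{n+1}(r) ≤ T⁻¹ (a/4 + (r-a)U²)` and `a < T`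
  have hsum : ∫ s in (0:ℝ)..r, u s ^ 2 ≤ a * (1 / 4) + (r - a) * U ^ 2 := by rw [hsplit]; linarith
  have hkey : (1 / 2 : ℝ) ≤ T⁻¹ * (a * (1 / 4) + (r - a) * U ^ 2) :=
    hlit.trans (h1.trans (mul_le_mul_of_nonneg_left hsum (inv_nonneg.2 hT.le)))
  have hkey' : T / 2 ≤ a * (1 / 4) + (r - a) * U ^ 2 := by
    have := mul_le_mul_of_nonneg_left hkey hT.le
    rwa [← mul_assoc, mul_inv_cancel₀ hT.ne', one_mul, mul_one_div] at this
  linarith [ha.2]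


/-- **HOP-TIME SUMMABILITY: `Σ_{n<N} U_n⁻² < 4`.** For a cancelling table and an exact flow on `[0,T)` (`T > 0`) from the
one-shell datum `X₀` at shell `0`, (4.5)-regular before `T`, whose critical amplitude is UNBOUNDED on `[0,T)` (blow-up), and
ANY peak bounds `C_A T Λ^{n+1}‖x_n(s)‖ ≤ U_n` on `[0,T)`: `Σ_{n<N} U_n⁻² < 4` for every `N`. (First-lit times
`s_n = inf{s ∈ [0,T) : u_n(s) ≥ 1/2}` exist by `everyShellFires`, increase with `n` by `orderedIgnition`, and
`s_{n+1} - s_n ≥ T/(4U_n²)` by `hopTime`; the hops telescope inside `[0,T)`.)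
[cite: Tao2016AveragedNS, §4 (4.3), Lemma 4.1 (4.5), (4.8)–(4.10), Thm. 4.2 (statement shape); §1.2] -/
theorem sum_inv_sq_peak_lt_four {ε₀ T : ℝ} (hε : 0 < ε₀) (hT : 0 < T)
    {α : Fin m → Fin m → Fin m → ℤ × ℤ × ℤ → ℝ} (hc : IsCancellingCoeff α)
    {X : Fin m → ℤ → ℝ → ℝ} {X₀ : Fin m → ℝ}
    (hder : ∀ i k, ∀ t ∈ Ico 0 T, HasDerivWithinAt (X i k) (quadTerm ε₀ α X i k t) (Ici 0) t)
    (hinit : ∀ i k, X i k 0 = if k = 0 then X₀ i else 0)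
    (hlow : ∀ i k t, k < 0 → X i k t = 0)
    (hreg : ∀ T' : ℝ, T' < T → ∃ M : ℝ, ∀ t ∈ Icc 0 T', ∀ (i : Fin m) (k : ℤ),
      (1 + (1 + ε₀) ^ ((10 : ℝ) * k)) * |X i k t| ≤ M)
    (hcrit : ∀ L : ℝ, ∃ t : ℝ, 0 ≤ t ∧ t < T ∧
      ∃ (i : Fin m) (k : ℤ), L < (1 + ε₀) ^ ((5 : ℝ) * k / 2) * |X i k t|)
    {U : ℕ → ℝ}
    (hU : ∀ n : ℕ, ∀ s ∈ Ico 0 T, fluxConst α * T * bigLam ε₀ ^ (n + 1) * ‖shellVec X (n : ℤ) s‖ ≤ U n)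
    (N : ℕ) : ∑ n ∈ Finset.range N, (U n ^ 2)⁻¹ < 4 := by
  have hfire := everyShellFires hε hT hc hder hinit hlow hreg hcrit
  -- lit sets and first-lit times
  let S : ℕ → Set ℝ := fun n =>
    {s | 0 ≤ s ∧ s < T ∧ 1 / 2 ≤ fluxConst α * T * bigLam ε₀ ^ (n + 1) * ‖shellVec X (n : ℤ) s‖}
  have hSne : ∀ n, (S n).Nonempty := fun n => by
    obtain ⟨t, ht0, htT, hlt⟩ := hfire n
    exact ⟨t, ht0, htT, by linarith⟩
  have hSbdd : ∀ n, BddBelow (S n) := fun n => ⟨0, fun s hs => hs.1⟩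
  let σ : ℕ → ℝ := fun n => sInf (S n)
  have hσ0 : ∀ n, 0 ≤ σ n := fun n => le_csInf (hSne n) fun s hs => hs.1
  have hσT : ∀ n, σ n < T := fun n => by
    obtain ⟨t, ht⟩ := hSne n
    exact lt_of_le_of_lt (csInf_le (hSbdd n) ht) ht.2.1
  have hunlit : ∀ n, ∀ s ∈ Ico 0 (σ n),
      fluxConst α * T * bigLam ε₀ ^ (n + 1) * ‖shellVec X (n : ℤ) s‖ < 1 / 2 := fun n s hs => by
    by_contra h
    push Not at h
    exact notMem_of_lt_csInf hs.2 (hSbdd n) ⟨hs.1, lt_trans hs.2 (hσT n), h⟩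
  have hUpos : ∀ n, 0 < U n := fun n => by
    obtain ⟨t, ht0, htT, hlt⟩ := hfire n
    exact lt_trans zero_lt_one (hlt.trans_le (hU n t ⟨ht0, htT⟩))
  -- one hop: `σ n + T/(4 U_n²) ≤ σ (n+1)`
  have hhop : ∀ n, σ n + T / 4 * (U n ^ 2)⁻¹ ≤ σ (n + 1) := fun n => by
    refine le_csInf (hSne (n + 1)) fun r hr => ?_
    have h := hopTime hε hT hc hder hinit hlow hreg n (a := σ n) (r := r) (U := U n) ⟨hσ0 n, hσT n⟩
      ⟨hr.1, hr.2.1⟩ (hunlit n) hr.2.2 (hU n)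
    have hU2 : 0 < U n ^ 2 := pow_pos (hUpos n) 2
    have : T / 4 * (U n ^ 2)⁻¹ < r - σ n := by
      rw [← div_eq_mul_inv, div_lt_iff₀ hU2]; exact h.2
    linarith
  -- telescope inside `[0,T)`
  have htel : ∀ M : ℕ, σ 0 + ∑ n ∈ Finset.range M, T / 4 * (U n ^ 2)⁻¹ ≤ σ M := by
    intro M
    induction M with
    | zero => simp
    | succ M ih =>
      rw [Finset.sum_range_succ]
      linarith [hhop M]
  have hlt : ∑ n ∈ Finset.range N, T / 4 * (U n ^ 2)⁻¹ < T := by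
    linarith [htel N, hσ0 0, hσT N]
  rw [← Finset.mul_sum] at hlt
  by_contra hge
  push Not at hge
  have : T ≤ T / 4 * ∑ n ∈ Finset.range N, (U n ^ 2)⁻¹ := by nlinarith
  linarith

/-- **THE PEAKS DIVERGE ALONG ALL BUT `4L²` SHELLS.** In the situation of `sum_inv_sq_peak_lt_four`, for every `L > 0`
fewer than `4L²` of the shells `n < N` have peak bound `U_n ≤ L`; in particular `sup_t Λ^n‖x_n(t)‖ → ∞` along the
complement of a set of shells of cardinality `< 4L²` at every level `L/(C_A T Λ)`.
[cite: Tao2016AveragedNS, §4 (4.3), Lemma 4.1 (4.5), (4.8)–(4.10), Thm. 4.2 (statement shape); §1.2] -/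
theorem card_quietPeaks_lt {ε₀ T : ℝ} (hε : 0 < ε₀) (hT : 0 < T)
    {α : Fin m → Fin m → Fin m → ℤ × ℤ × ℤ → ℝ} (hc : IsCancellingCoeff α)
    {X : Fin m → ℤ → ℝ → ℝ} {X₀ : Fin m → ℝ}
    (hder : ∀ i k, ∀ t ∈ Ico 0 T, HasDerivWithinAt (X i k) (quadTerm ε₀ α X i k t) (Ici 0) t)
    (hinit : ∀ i k, X i k 0 = if k = 0 then X₀ i else 0)
    (hlow : ∀ i k t, k < 0 → X i k t = 0)
    (hreg : ∀ T' : ℝ, T' < T → ∃ M : ℝ, ∀ t ∈ Icc 0 T', ∀ (i : Fin m) (k : ℤ),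
      (1 + (1 + ε₀) ^ ((10 : ℝ) * k)) * |X i k t| ≤ M)
    (hcrit : ∀ L : ℝ, ∃ t : ℝ, 0 ≤ t ∧ t < T ∧
      ∃ (i : Fin m) (k : ℤ), L < (1 + ε₀) ^ ((5 : ℝ) * k / 2) * |X i k t|)
    {U : ℕ → ℝ}
    (hU : ∀ n : ℕ, ∀ s ∈ Ico 0 T, fluxConst α * T * bigLam ε₀ ^ (n + 1) * ‖shellVec X (n : ℤ) s‖ ≤ U n)
    {L : ℝ} (hL : 0 < L) (N : ℕ) :
    ((((Finset.range N).filter fun n => U n ≤ L).card : ℕ) : ℝ) < 4 * L ^ 2 := by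
  have hfire := everyShellFires hε hT hc hder hinit hlow hreg hcrit
  have hUpos : ∀ n, 0 < U n := fun n => by
    obtain ⟨t, ht0, htT, hlt⟩ := hfire n
    exact lt_trans zero_lt_one (hlt.trans_le (hU n t ⟨ht0, htT⟩))
  have hsum := sum_inv_sq_peak_lt_four hε hT hc hder hinit hlow hreg hcrit hU N
  set F := (Finset.range N).filter fun n => U n ≤ L with hF
  have h1 : ∑ n ∈ F, (U n ^ 2)⁻¹ ≤ ∑ n ∈ Finset.range N, (U n ^ 2)⁻¹ :=
    Finset.sum_le_sum_of_subset_of_nonneg (Finset.filter_subset _ _) fun n _ _ =>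
      inv_nonneg.2 (pow_nonneg (hUpos n).le 2)
  have h2 : ∑ n ∈ F, (L ^ 2)⁻¹ ≤ ∑ n ∈ F, (U n ^ 2)⁻¹ := by
    refine Finset.sum_le_sum fun n hn => ?_
    have hnL : U n ≤ L := (Finset.mem_filter.1 hn).2
    exact inv_anti₀ (pow_pos (hUpos n) 2) (pow_le_pow_left₀ (hUpos n).le hnL 2)
  rw [Finset.sum_const, nsmul_eq_mul] at h2
  have hL2 : 0 < L ^ 2 := by positivity
  have h3 : (F.card : ℝ) * (L ^ 2)⁻¹ < 4 := lt_of_le_of_lt (h2.trans h1) hsum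
  rwa [← div_eq_mul_inv, div_lt_iff₀ hL2] at h3

/-! ### Along a robust blow-up -/

/-- **ORDERED IGNITION AND HOP-TIME SUMMABILITY ALONG A ROBUST BLOW-UP.** If `NoGlobalCascade ε₀ α X₀` (`ε₀ > 0`,
`α ∈ E₂(R)`, any `m`), then along the maximal exact cascade flow `X` from the one-shell datum on `[0,T⋆)`
(`criticalBlowup_of_noGlobalCascade`): (i) shell `n+1` is lit (`C_A T⋆ Λ^{n+2}‖x_{n+1}(r)‖ ≥ 1/2`) only after shell `n` was lit
at some `r' ≤ r`; (ii) for any peak bounds `C_A T⋆ Λ^{n+1}‖x_n‖ ≤ U_n` on `[0,T⋆)`, `Σ_{n<N} U_n⁻² < 4` for every `N`, and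
fewer than `4L²` shells `n < N` have `U_n ≤ L` (`L > 0`).
[cite: Tao2016AveragedNS, §4 Thm. 4.2 (statement shape), (4.3), Lemma 4.1 (4.5), (4.8)–(4.10), (4.12); §1.2] -/
theorem hopTimes_of_noGlobalCascade {ε₀ R : ℝ} (hε : 0 < ε₀)
    {α : Fin m → Fin m → Fin m → ℤ × ℤ × ℤ → ℝ} {X₀ : Fin m → ℝ} (hα : InTableClass R α)
    (hNG : NoGlobalCascade ε₀ α X₀) :
    ∃ (T : ℝ) (X : Fin m → ℤ → ℝ → ℝ), 0 < T ∧
      (∀ i n, ContDiffOn ℝ 1 (X i n) (Set.Ico 0 T)) ∧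
      (∀ i n, X i n 0 = if n = 0 then X₀ i else 0) ∧
      (∀ i n t, n < 0 → X i n t = 0) ∧
      (∀ i n t, 0 ≤ t → t < T → derivWithin (X i n) (Set.Ici 0) t = quadTerm ε₀ α X i n t) ∧
      (∀ T' : ℝ, 0 < T' → T' < T → ∃ M : ℝ, ∀ t : ℝ, 0 ≤ t → t ≤ T' →
        ∀ (i : Fin m) (n : ℤ), (1 + (1 + ε₀) ^ ((10 : ℝ) * n)) * |X i n t| ≤ M) ∧
      (∀ (n : ℕ), ∀ r ∈ Ico (0:ℝ) T,
        1 / 2 ≤ fluxConst α * T * bigLam ε₀ ^ (n + 1 + 1) * ‖shellVec X ((n + 1 : ℕ) : ℤ) r‖ →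
          ∃ r' ∈ Icc 0 r, 1 / 2 ≤ fluxConst α * T * bigLam ε₀ ^ (n + 1) * ‖shellVec X (n : ℤ) r'‖) ∧
      (∀ U : ℕ → ℝ, (∀ n : ℕ, ∀ s ∈ Ico (0:ℝ) T,
          fluxConst α * T * bigLam ε₀ ^ (n + 1) * ‖shellVec X (n : ℤ) s‖ ≤ U n) →
        (∀ N : ℕ, ∑ n ∈ Finset.range N, (U n ^ 2)⁻¹ < 4) ∧
        (∀ L : ℝ, 0 < L → ∀ N : ℕ, ((((Finset.range N).filter fun n => U n ≤ L).card : ℕ) : ℝ) < 4 * L ^ 2)) := by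
  obtain ⟨T, X, hT, h1, h2, h3, h4, h5, h6⟩ := criticalBlowup_of_noGlobalCascade hε hα hNG
  have hder : ∀ i k, ∀ τ ∈ Ico (0 : ℝ) T,
      HasDerivWithinAt (X i k) (quadTerm ε₀ α X i k τ) (Ici 0) τ := by
    intro i k τ hτ
    have hd : DifferentiableWithinAt ℝ (X i k) (Ico 0 T) τ :=
      ((h1 i k).differentiableOn one_ne_zero) τ hτ
    have hd' : DifferentiableWithinAt ℝ (X i k) (Ici 0) τ :=
      hd.mono_of_mem_nhdsWithin (by
        rw [mem_nhdsWithin]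
        exact ⟨Iio T, isOpen_Iio, hτ.2, fun x hx => ⟨hx.2, hx.1⟩⟩)
    rw [← h4 i k τ hτ.1 hτ.2]
    exact hd'.hasDerivWithinAt
  have hreg : ∀ T' : ℝ, T' < T → ∃ M : ℝ, ∀ τ ∈ Icc (0 : ℝ) T', ∀ (i : Fin m) (k : ℤ),
      (1 + (1 + ε₀) ^ ((10 : ℝ) * k)) * |X i k τ| ≤ M := by
    intro T' hT'
    rcases le_or_gt T' 0 with h0 | h0
    · obtain ⟨M, hM⟩ := h5 (T / 2) (by linarith) (by linarith)
      exact ⟨M, fun τ hτ i k => hM τ hτ.1 (by linarith [hτ.2]) i k⟩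
    · obtain ⟨M, hM⟩ := h5 T' h0 hT'
      exact ⟨M, fun τ hτ i k => hM τ hτ.1 hτ.2 i k⟩
  refine ⟨T, X, hT, h1, h2, h3, h4, h5, fun n r hr hlit => orderedIgnition hε hT hα.2.1 hder h2 h3 hreg n hr hlit,
    fun U hU => ⟨fun N => sum_inv_sq_peak_lt_four hε hT hα.2.1 hder h2 h3 hreg h6 hU N,
      fun L hL N => card_quietPeaks_lt hε hT hα.2.1 hder h2 h3 hreg h6 hU hL N⟩⟩

end BlowupRigidityOne

end Summit.NavierStokesRegularity.NavierStokesRegularity.Theorems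

end
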